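import Literature.Analysis.FluidPDE.AxisymWeights
import HarnessLib

/-!
# The `L²` balance `‖g(b)‖² = ‖g(0)‖² + 2∫₀ᵇ∫ g ∂ₜg` from time-line derivatives almost everywhere

Analysis/FluidPDE support file (measure theory only; theorems, no definitions, no named facts) on
the discharge path of the named facts `Literature.Analysis.FluidPDE.LeiZhang2017_logModulus_regularity`,
`…LeiZhang2017_smallSwirl_regularity`, `…Wei2016_logModulus_regularity`: the step "integrating
the above inequality with respect to time" of Lei–Zhang 2017, §3 (arXiv:1505.02628, p. 8–9), for
energies `∫ g(t,x)² dx` of fields `g` (the quotients `Ω = ω^θ/r`, `J = ωʳ/r`, …) which are known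
to be smooth in `t` only along almost every time line (off the symmetry axis), in the spirit of the
tree's `IsSmoothSpaceTimeOn.enstrophy_balance` / `.l2_balance` (which assume joint smoothness):

* `integral_sq_eq_add_of_ae_hasDerivAt` — if for a.e. `x` the time line `t ↦ g t x` is continuous
  on `[0, T]` with derivative `g' t x` on `(0, T)` (`g'(·, x)` continuous on `[0, T]`), the product
  `g g'` is a.e.-strongly measurable on `(0, T) × X` with `sup_t ∫ |g g'| < ∞`, and the slices `g(t)²`
  are integrable, then `∫ g(b)² = ∫ g(0)² + 2 ∫_{(0,b)} ∫ g g'` for `b ∈ (0, T]` (fundamental theorem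
  of calculus on a.e. time line, Fubini);
* `integral_sq_le_add_of_ae_hasDerivAt` — the inequality form with a majorant `∫ g g' ≤ h(t)`;
* `aestronglyMeasurable_prod_of_continuousOn_off_axis` — on `ℝ³`, joint continuity on
  `(0, T) × {r ≠ 0}` suffices for the measurability hypothesis (the axis is null,
  `volume_axis_eq_zero`).

## Mathlib / tree search

Mathlib: `intervalIntegral.integral_eq_sub_of_hasDerivAt_of_le`, `integral_integral_swap`,
`lintegral_prod_le`, `Measure.restrict_prod_eq_prod_univ`, `Measure.prod_restrict`,
`Measure.restrict_congr_set`, `ContinuousOn.aestronglyMeasurable`. Tree: `volume_axis_eq_zero`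
(`AxisymWeights`), the pattern of `IsSmoothSpaceTimeOn.enstrophy_balance` (`SerrinEnstrophyGronwall`).

## References

* Z. Lei, Q. S. Zhang, Pacific J. Math. 289 (2017) 169–187, arXiv:1505.02628, §3, pp. 8–9.
  [`LeiZhang2017`]
-/

noncomputable section

open MeasureTheory Set Function Filter Topology
open scoped ENNReal NNReal

namespace Literature.Analysis.FluidPDE

/-! ### The balance -/

section Balance

variable {X : Type*} [MeasurableSpace X] {μ : Measure X} [SFinite μ]

/-- **`L²` balance from a.e. time-line derivatives.** Let `T > 0` and `g g' : ℝ → X → ℝ`. Assume: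
for `μ`-a.e. `x`, `t ↦ g t x` and `t ↦ g' t x` are continuous on `[0, T]` and
`t ↦ g t x` has derivative `g' t x` at every `t ∈ (0, T)`; `(t, x) ↦ g t x · g' t x` is
a.e.-strongly measurable for `(vol|_(0,T)) × μ` with `∫ |g(t) g'(t)| dμ ≤ K < ∞` for `t ∈ (0, T)`;
and each slice `g(t)²`, `t ∈ [0, T]`, is integrable. Then for `b ∈ (0, T]`,
`∫ g(b)² dμ = ∫ g(0)² dμ + 2 ∫_{t ∈ (0,b)} ∫ g(t) g'(t) dμ dt`. [folklore] -/
theorem integral_sq_eq_add_of_ae_hasDerivAt {T : ℝ} {g g' : ℝ → X → ℝ}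
    (hline : ∀ᵐ x ∂μ, ContinuousOn (fun t => g t x) (Icc 0 T) ∧
      ContinuousOn (fun t => g' t x) (Icc 0 T) ∧ ∀ t ∈ Ioo 0 T, HasDerivAt (fun t => g t x) (g' t x) t)
    (hmeas : AEStronglyMeasurable (uncurry fun t x => g t x * g' t x)
      ((volume.restrict (Ioo 0 T)).prod μ))
    {K : ℝ≥0∞} (hK : K ≠ ⊤) (hbound : ∀ t ∈ Ioo 0 T, ∫⁻ x, ‖g t x * g' t x‖ₑ ∂μ ≤ K)
    (hsq : ∀ t ∈ Icc 0 T, Integrable (fun x => g t x ^ 2) μ) {b : ℝ} (hb : b ∈ Ioc 0 T) :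
    ∫ x, g b x ^ 2 ∂μ = (∫ x, g 0 x ^ 2 ∂μ) + 2 * ∫ t in Ioo 0 b, ∫ x, g t x * g' t x ∂μ := by
  have hT : 0 < T := hb.1.trans_le hb.2
  -- the product measure on `(0, b) × X` as a restriction of the one on `(0, T) × X`
  set μb : Measure (ℝ × X) := (volume.restrict (Ioo 0 b)).prod μ with hμb
  have hμb' : μb = ((volume.restrict (Ioo 0 T)).prod μ).restrict (Ioo 0 b ×ˢ univ) := by
    rw [hμb, ← Measure.prod_restrict, Measure.restrict_univ,
      Measure.restrict_restrict measurableSet_Ioo,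
      inter_eq_self_of_subset_left (Ioo_subset_Ioo le_rfl hb.2)]
  have hmeas_b : AEStronglyMeasurable (uncurry fun t x => g t x * g' t x) μb := by
    rw [hμb']; exact hmeas.restrict
  -- product integrability on `(0, b) × X`
  have hI : Integrable (uncurry fun t x => g t x * g' t x) μb := by
    refine ⟨hmeas_b, ?_⟩
    have hle := lintegral_prod_le (μ := volume.restrict (Ioo 0 b)) (ν := μ)
      (fun z : ℝ × X => ‖uncurry (fun t x => g t x * g' t x) z‖ₑ)
    refine lt_of_le_of_lt hle ?_
    calc ∫⁻ t in Ioo 0 b, ∫⁻ x, ‖uncurry (fun t x => g t x * g' t x) (t, x)‖ₑ ∂μ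
        ≤ ∫⁻ _ in Ioo 0 b, K := setLIntegral_mono' measurableSet_Ioo fun t ht =>
            hbound t ⟨ht.1, ht.2.trans_le hb.2⟩
      _ < ⊤ := by
          rw [setLIntegral_const]
          exact ENNReal.mul_lt_top hK.lt_top (by simp)
  have hI2 : Integrable (uncurry fun t x => 2 * (g t x * g' t x)) μb := hI.const_mul 2
  -- the fundamental theorem of calculus on a.e. time line
  have hFTC : ∀ᵐ x ∂μ, ∫ t in Ioo 0 b, 2 * (g t x * g' t x) = g b x ^ 2 - g 0 x ^ 2 := by
    filter_upwards [hline] with x hx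
    obtain ⟨hgc, hg'c, hder⟩ := hx
    have hsub : Icc 0 b ⊆ Icc 0 T := Icc_subset_Icc le_rfl hb.2
    have hsq2 : (fun t => g t x ^ 2) = fun t => g t x * g t x := funext fun t => sq _
    have hcont : ContinuousOn (fun t => g t x ^ 2) (Icc 0 b) := (hgc.mono hsub).pow 2
    have hderiv : ∀ t ∈ Ioo 0 b, HasDerivAt (fun t => g t x ^ 2) (2 * (g t x * g' t x)) t := by
      intro t ht
      have h := (hder t ⟨ht.1, ht.2.trans_le hb.2⟩).mul (hder t ⟨ht.1, ht.2.trans_le hb.2⟩)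
      have e : g' t x * g t x + g t x * g' t x = 2 * (g t x * g' t x) := by ring
      rw [hsq2, ← e]
      exact h
    have hint : IntervalIntegrable (fun t => 2 * (g t x * g' t x)) volume 0 b :=
      (continuousOn_const.mul ((hgc.mono hsub).mul (hg'c.mono hsub))).intervalIntegrable_of_Icc
        hb.1.le
    have h := intervalIntegral.integral_eq_sub_of_hasDerivAt_of_le hb.1.le hcont hderiv hint
    rwa [intervalIntegral.integral_of_le hb.1.le, integral_Ioc_eq_integral_Ioo] at h
  -- Fubini
  have hswap := integral_integral_swap (μ := volume.restrict (Ioo 0 b)) (ν := μ)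
    (f := fun t x => 2 * (g t x * g' t x)) hI2
  have hx : ∫ x, (∫ t in Ioo 0 b, 2 * (g t x * g' t x)) ∂μ =
      (∫ x, g b x ^ 2 ∂μ) - ∫ x, g 0 x ^ 2 ∂μ := by
    rw [integral_congr_ae hFTC, integral_sub (hsq b ⟨hb.1.le, hb.2⟩) (hsq 0 ⟨le_rfl, hT.le⟩)]
  have h2 : ∫ t in Ioo 0 b, ∫ x, 2 * (g t x * g' t x) ∂μ =
      2 * ∫ t in Ioo 0 b, ∫ x, g t x * g' t x ∂μ := by
    rw [← integral_const_mul]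
    exact integral_congr_ae (Eventually.of_forall fun t => integral_const_mul _ _)
  rw [← h2, hswap, hx]
  ring

/-- **`L²` balance, inequality form.** Under the hypotheses of
`integral_sq_eq_add_of_ae_hasDerivAt`, if `∫ g(t) g'(t) dμ ≤ h t` for `t ∈ (0, T)` with `h`
integrable on `(0, T)`, then `∫ g(b)² ≤ ∫ g(0)² + 2 ∫_{(0,b)} h` for `b ∈ (0, T]`. [folklore] -/
theorem integral_sq_le_add_of_ae_hasDerivAt {T : ℝ} {g g' : ℝ → X → ℝ}
    (hline : ∀ᵐ x ∂μ, ContinuousOn (fun t => g t x) (Icc 0 T) ∧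
      ContinuousOn (fun t => g' t x) (Icc 0 T) ∧ ∀ t ∈ Ioo 0 T, HasDerivAt (fun t => g t x) (g' t x) t)
    (hmeas : AEStronglyMeasurable (uncurry fun t x => g t x * g' t x)
      ((volume.restrict (Ioo 0 T)).prod μ))
    {K : ℝ≥0∞} (hK : K ≠ ⊤) (hbound : ∀ t ∈ Ioo 0 T, ∫⁻ x, ‖g t x * g' t x‖ₑ ∂μ ≤ K)
    (hsq : ∀ t ∈ Icc 0 T, Integrable (fun x => g t x ^ 2) μ)
    {h : ℝ → ℝ} (hh : IntegrableOn h (Ioo 0 T)) (hle : ∀ t ∈ Ioo 0 T, ∫ x, g t x * g' t x ∂μ ≤ h t)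
    {b : ℝ} (hb : b ∈ Ioc 0 T) :
    ∫ x, g b x ^ 2 ∂μ ≤ (∫ x, g 0 x ^ 2 ∂μ) + 2 * ∫ t in Ioo 0 b, h t := by
  rw [integral_sq_eq_add_of_ae_hasDerivAt hline hmeas hK hbound hsq hb]
  have hsubT : Ioo 0 b ⊆ Ioo 0 T := Ioo_subset_Ioo le_rfl hb.2
  -- integrability of `t ↦ ∫ g g'` on `(0, b)` (Fubini)
  set μb : Measure (ℝ × X) := (volume.restrict (Ioo 0 b)).prod μ with hμb
  have hμb' : μb = ((volume.restrict (Ioo 0 T)).prod μ).restrict (Ioo 0 b ×ˢ univ) := by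
    rw [hμb, ← Measure.prod_restrict, Measure.restrict_univ,
      Measure.restrict_restrict measurableSet_Ioo, inter_eq_self_of_subset_left hsubT]
  have hI : Integrable (uncurry fun t x => g t x * g' t x) μb := by
    refine ⟨by rw [hμb']; exact hmeas.restrict, ?_⟩
    have hle' := lintegral_prod_le (μ := volume.restrict (Ioo 0 b)) (ν := μ)
      (fun z : ℝ × X => ‖uncurry (fun t x => g t x * g' t x) z‖ₑ)
    refine lt_of_le_of_lt hle' ?_
    calc ∫⁻ t in Ioo 0 b, ∫⁻ x, ‖uncurry (fun t x => g t x * g' t x) (t, x)‖ₑ ∂μ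
        ≤ ∫⁻ _ in Ioo 0 b, K := setLIntegral_mono' measurableSet_Ioo fun t ht =>
            hbound t (hsubT ht)
      _ < ⊤ := by
          rw [setLIntegral_const]
          exact ENNReal.mul_lt_top hK.lt_top (by simp)
  have hF : IntegrableOn (fun t => ∫ x, g t x * g' t x ∂μ) (Ioo 0 b) := hI.integral_prod_left
  have hmono : ∫ t in Ioo 0 b, ∫ x, g t x * g' t x ∂μ ≤ ∫ t in Ioo 0 b, h t :=
    setIntegral_mono_on hF (hh.mono_set hsubT) measurableSet_Ioo fun t ht => hle t (hsubT ht)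
  linarith

end Balance

/-! ### Measurability on `(0, T) × ℝ³` from continuity off the axis -/

section OffAxis

/-- The axis `{r = 0}` of `ℝ³` is Lebesgue-null (`volume_axis_eq_zero`). [folklore] -/
theorem volume_setOf_cylRadius_eq_zero :
    volume {x : EuclideanSpace ℝ (Fin 3) | cylRadius x = 0} = 0 := by
  have h : {x : EuclideanSpace ℝ (Fin 3) | cylRadius x = 0} =
      {x : EuclideanSpace ℝ (Fin 3) | x 0 ^ 2 + x 1 ^ 2 = 0} := by
    ext x
    simp only [mem_setOf_eq]
    rw [← cylRadius_sq, pow_eq_zero_iff two_ne_zero]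
  rw [h]
  exact volume_axis_eq_zero

/-- **Joint measurability from continuity off the axis.** A function on `ℝ × ℝ³` continuous on
`(0, T) × {r ≠ 0}` is a.e.-strongly measurable for `vol|_(0,T) × vol` (the complement
`(0, T) × {r = 0}` of the open set of continuity inside the slab is null). [folklore] -/
theorem aestronglyMeasurable_prod_of_continuousOn_off_axis {β : Type*} [TopologicalSpace β]
    [TopologicalSpace.PseudoMetrizableSpace β] {T : ℝ} {F : ℝ × EuclideanSpace ℝ (Fin 3) → β}
    (hF : ContinuousOn F (Ioo 0 T ×ˢ {x | cylRadius x ≠ 0})) :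
    AEStronglyMeasurable F ((volume.restrict (Ioo 0 T)).prod volume) := by
  set A : Set (ℝ × EuclideanSpace ℝ (Fin 3)) := Ioo 0 T ×ˢ {x | cylRadius x ≠ 0} with hA
  have hopen : IsOpen {x : EuclideanSpace ℝ (Fin 3) | cylRadius x ≠ 0} :=
    isOpen_ne_fun continuous_cylRadius continuous_const
  have hAm : MeasurableSet A := measurableSet_Ioo.prod hopen.measurableSet
  have hμ : (volume.restrict (Ioo 0 T)).prod (volume : Measure (EuclideanSpace ℝ (Fin 3))) =
      ((volume : Measure ℝ).prod (volume : Measure (EuclideanSpace ℝ (Fin 3)))).restrict A := by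
    rw [Measure.restrict_prod_eq_prod_univ]
    refine Measure.restrict_congr_set ?_
    -- `(0,T) × univ` and `(0,T) × {r ≠ 0}` differ by the null set `(0,T) × {r = 0}`
    have hdiff : (Ioo (0 : ℝ) T ×ˢ (univ : Set (EuclideanSpace ℝ (Fin 3)))) \ A =
        Ioo 0 T ×ˢ {x | cylRadius x = 0} := by
      ext p
      constructor
      · rintro ⟨⟨h1, -⟩, h2⟩
        refine ⟨h1, ?_⟩
        by_contra h3
        exact h2 ⟨h1, h3⟩
      · rintro ⟨h1, h2⟩
        have h2' : cylRadius p.2 = 0 := h2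
        exact ⟨⟨h1, mem_univ _⟩, fun h3 => h3.2 h2'⟩
    have hnull : ((volume : Measure ℝ).prod (volume : Measure (EuclideanSpace ℝ (Fin 3))))
        ((Ioo (0 : ℝ) T ×ˢ (univ : Set (EuclideanSpace ℝ (Fin 3)))) \ A) = 0 := by
      rw [hdiff, Measure.prod_prod, volume_setOf_cylRadius_eq_zero, mul_zero]
    have hsub : A ⊆ Ioo (0 : ℝ) T ×ˢ (univ : Set (EuclideanSpace ℝ (Fin 3))) :=
      prod_mono Subset.rfl (subset_univ _)
    exact ae_eq_set.2 ⟨hnull, measure_mono_null (fun p hp => absurd (hsub hp.1) hp.2) measure_empty⟩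
  rw [hμ]
  exact hF.aestronglyMeasurable hAm

end OffAxis

end Literature.Analysis.FluidPDE
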